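import Summits.QuantumFields.GaugeBoot.OneOverNLimit
import HarnessLib

/-!
# The `1/N` expansion to all orders, II: the abstract Cauchy step (gauge-boot, ADDENDUM 30 part B)

HONEST FRAMING (cell `pub-gaugeboot`, page 1 of every file): the venture produces certified bounds
on lattice expectations at stated coupling, gauge group, dimension and torus size; NOT a mass gap,
NOT a continuum limit, NOT a string tension; NOT Yang–Mills-summit-bearing (barriers
`FixedCouplingUltralocality`, `PerturbativeInvisibility`).  Strong-coupling `SO(N)` lattice gauge theory with free boundary
condition (S. Chatterjee, Comm. Math. Phys. **366** (2019); the `1/N` expansion: S. Chatterjee, J. Jafarov, arXiv:1604.04777);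
nothing about four-dimensional continuum Yang–Mills or a mass gap.

## Content

★ `cauchy_of_apriori` — the convergence mechanism of the lane's `1/N` expansion, isolated from the order: let `Q_N : 𝒮 → ℝ`
(«the order-`k` remainder on the cube `[−M_N, M_N]^d`») be constant at `∅`, satisfy eventually the linearised symmetrized master
loop equation `|t| Q_N(t) − (Σ_{𝕊⁻}Q_N − Σ_{𝕊⁺}Q_N + βΣ_{𝔻⁻}Q_N − βΣ_{𝔻⁺}Q_N) = SRC_N(t)` at every genuine non-null `t` with its
unit neighbourhood in the cube, with a source `SRC_N(t)` that CONVERGES for every genuine `t`, and obey eventually the a priori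
bound `|Q_N(t)| ≤ B Φ_K(t)` for the genuine `t` whose `D_N`-neighbourhood lies in the cube, where `M_N − D_N → ∞`.  Then
`(Q_N(s))_N` converges for every genuine `s` (inside the contraction regime `2/K + 1024(d−1)K⁴|β| ≤ 3/4`).  Proof: `Q_N − Q_{N'}`
satisfies the equation with source `SRC_N − SRC_{N'}`, eventually small on the finitely many descendants of `s` up to generation
`n`; the leaves carry `2BΦ`; `contraction_iterate` gives `|Q_N(s) − Q_{N'}(s)| ≤ (2Bθⁿ + 4η)Φ(s)`: Cauchy.  (This is the
argument of the sibling `OneOverNLimit.tendsto_firstOrderCorrection`, made order-free.)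

Everything is `[folklore]` given ADDENDA 28–29.
-/

noncomputable section

open Filter Topology
open Literature.Probability.LatticeModels (Site box)
open Literature.MathematicalPhysics.QuantumFieldTheory (latticeNorm)
open Literature.MathematicalPhysics.QuantumFieldTheory.Chatterjee2019LargeN
open Literature.MathematicalPhysics.QuantumFieldTheory.Chatterjee2019LargeN.CoeffCatalanBoundProof

namespace Summit.QuantumFields.GaugeBoot

namespace StringDuality

variable {d : ℕ}

/-- ★ **The abstract Cauchy step of the `1/N` expansion.**  See the module docstring.
[cite: ChatterjeeJafarov2016OneOverN, Theorem 5.1 (existence of the limits f_k); Chatterjee2019LargeN, Theorem 9.9, Lemma 10.1] -/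
theorem cauchy_of_apriori {K β B : ℝ} (hK4 : 4 ≤ K) (hB : 0 ≤ B)
    (hθ : 2 / K + |β| * (2 * ((2 * (d - 1) : ℕ) : ℝ) * 256 * K ^ 4) ≤ 3 / 4)
    (M D : ℕ → ℕ) (hD : ∀ a : ℕ, ∀ᶠ N : ℕ in atTop, D N + a ≤ M N)
    (Q SRC : ℕ → LoopSeq d → ℝ) (h0 : ∀ N N' : ℕ, Q N [] = Q N' [])
    (hE : ∀ᶠ N : ℕ in atTop, ∀ t : LoopSeq d, IsLoopSeq t → t ≠ [] →
      (∀ l ∈ t, ∀ a ∈ l, ∀ v : Site d,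
        latticeNorm (v - DEdge.src a) ≤ 1 ∨ latticeNorm (v - DEdge.tgt a) ≤ 1 → v ∈ box d (M N)) →
      (t.len : ℝ) * Q N t -
          ((∑ o : InvIdx t, Q N (t.negSplitAt o)) - (∑ o : SameIdx t, Q N (t.posSplitAt o))
            + β * (∑ o : DeformIdx t, Q N (t.negDeformAt o)) - β * (∑ o : DeformIdx t, Q N (t.posDeformAt o))) =
        SRC N t)
    (hSRC : ∀ t : LoopSeq d, IsLoopSeq t → ∃ L : ℝ, Tendsto (fun N : ℕ => SRC N t) atTop (𝓝 L))
    (hAP : ∀ᶠ N : ℕ in atTop, ∀ t : LoopSeq d, IsLoopSeq t →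
      (∀ l ∈ t, ∀ a ∈ l, ∀ v : Site d,
        latticeNorm (v - DEdge.src a) ≤ (D N : ℕ) ∨ latticeNorm (v - DEdge.tgt a) ≤ (D N : ℕ) → v ∈ box d (M N)) →
      |Q N t| ≤ B * (K ^ t.index * catProd t)) :
    ∀ s : LoopSeq d, IsLoopSeq s → ∃ q : ℝ, Tendsto (fun N : ℕ => Q N s) atTop (𝓝 q) := by
  intro s hs
  have hK0 : 0 < K := by linarith
  set P : ℝ := ((2 * (d - 1) : ℕ) : ℝ) with hPdef
  obtain ⟨θ, hθdef⟩ : ∃ θ : ℝ, θ = 2 / K + |β| * (2 * P * 256 * K ^ 4) := ⟨_, rfl⟩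
  have hθ0 : 0 ≤ θ := by rw [hθdef]; positivity
  have hθ1 : θ ≤ 3 / 4 := by rw [hθdef, hPdef]; exact hθ
  set Φ : LoopSeq d → ℝ := fun t => K ^ t.index * catProd t with hΦ
  have hΦpos : ∀ t, 0 < Φ t := fun t => mul_pos (pow_pos hK0 _) (lt_of_lt_of_le one_pos (one_le_catProd t))
  -- the vertices of `s` lie in a cube
  obtain ⟨r, hr⟩ := exists_vertices_mem_box s
  have hcauchy : CauchySeq fun N => Q N s := by
    rw [Metric.cauchySeq_iff]
    intro ε hε
    -- depth `n` and source tolerance `η`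
    obtain ⟨n, hn⟩ : ∃ n : ℕ, 2 * B * θ ^ n * Φ s < ε / 2 := by
      have h := ((tendsto_pow_atTop_nhds_zero_of_lt_one hθ0 (by linarith)).const_mul (2 * B)).mul_const (Φ s)
      rw [mul_zero, zero_mul] at h
      exact (h.eventually (gt_mem_nhds (by positivity))).exists
    set η : ℝ := ε / (16 * Φ s) with hη
    have hΦs0 : Φ s ≠ 0 := (hΦpos s).ne'
    have hη0 : 0 < η := by rw [hη]; exact div_pos hε (mul_pos (by norm_num) (hΦpos s))
    have hη' : 4 * η * Φ s = ε / 4 := by rw [hη]; field_simp; ring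
    -- the source-tolerance predicate on descendants, by recursion on the generation
    let Src : ℕ × ℕ → ℕ → LoopSeq d → Prop := fun q =>
      Nat.rec (motive := fun _ => LoopSeq d → Prop) (fun _ => True) fun m G t =>
        (IsLoopSeq t → t ≠ [] → |SRC q.1 t - SRC q.2 t| ≤ η * t.len * Φ t) ∧
          (∀ o : SameIdx t, G (t.posSplitAt o)) ∧ (∀ o : InvIdx t, G (t.negSplitAt o)) ∧
          (∀ o : DeformIdx t, G (t.posDeformAt o)) ∧ (∀ o : DeformIdx t, G (t.negDeformAt o))
    have hSrc_ev : ∀ (m : ℕ) (t : LoopSeq d), ∀ᶠ q : ℕ × ℕ in atTop, Src q m t := by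
      intro m
      induction m with
      | zero => intro t; exact Eventually.of_forall fun q => trivial
      | succ m ih =>
        intro t
        have h0' : ∀ᶠ q : ℕ × ℕ in atTop, IsLoopSeq t → t ≠ [] → |SRC q.1 t - SRC q.2 t| ≤ η * t.len * Φ t := by
          by_cases ht : IsLoopSeq t
          · by_cases htne : t = []
            · exact Eventually.of_forall fun q _ h => (h htne).elim
            · obtain ⟨L, hL⟩ := hSRC t ht
              have hpos : 0 < η * t.len * Φ t := by
                have : (0 : ℝ) < t.len := by exact_mod_cast LoopSeq.len_pos ht htne
                exact mul_pos (mul_pos hη0 this) (hΦpos t)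
              filter_upwards [eventually_abs_sub_le_of_tendsto hL hpos] with q hq _ _
              exact hq
          · exact Eventually.of_forall fun q h => (ht h).elim
        have h1 : ∀ᶠ q : ℕ × ℕ in atTop, ∀ o : SameIdx t, Src q m (t.posSplitAt o) := eventually_all.mpr fun o => ih _
        have h2 : ∀ᶠ q : ℕ × ℕ in atTop, ∀ o : InvIdx t, Src q m (t.negSplitAt o) := eventually_all.mpr fun o => ih _
        have h3 : ∀ᶠ q : ℕ × ℕ in atTop, ∀ o : DeformIdx t, Src q m (t.posDeformAt o) := eventually_all.mpr fun o => ih _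
        have h4 : ∀ᶠ q : ℕ × ℕ in atTop, ∀ o : DeformIdx t, Src q m (t.negDeformAt o) := eventually_all.mpr fun o => ih _
        filter_upwards [h0', h1, h2, h3, h4] with q a b c e f
        exact ⟨a, b, c, e, f⟩
    -- conditions on a single `N`: the equation, the a priori bound, the depth `D N + (r + n) ≤ M N`
    have hN_ev : ∀ᶠ N : ℕ in atTop,
        (∀ t : LoopSeq d, IsLoopSeq t → t ≠ [] →
          (∀ l ∈ t, ∀ a ∈ l, ∀ v : Site d,
            latticeNorm (v - DEdge.src a) ≤ 1 ∨ latticeNorm (v - DEdge.tgt a) ≤ 1 → v ∈ box d (M N)) →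
          (t.len : ℝ) * Q N t -
              ((∑ o : InvIdx t, Q N (t.negSplitAt o)) - (∑ o : SameIdx t, Q N (t.posSplitAt o))
                + β * (∑ o : DeformIdx t, Q N (t.negDeformAt o)) - β * (∑ o : DeformIdx t, Q N (t.posDeformAt o))) =
            SRC N t) ∧
        (∀ t : LoopSeq d, IsLoopSeq t →
          (∀ l ∈ t, ∀ a ∈ l, ∀ v : Site d,
            latticeNorm (v - DEdge.src a) ≤ (D N : ℕ) ∨ latticeNorm (v - DEdge.tgt a) ≤ (D N : ℕ) → v ∈ box d (M N)) →
          |Q N t| ≤ B * (K ^ t.index * catProd t)) ∧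
        D N + (r + n) ≤ M N := by
      filter_upwards [hE, hAP, hD (r + n)] with N a b c
      exact ⟨a, b, c⟩
    obtain ⟨q₀, hq₀⟩ := eventually_atTop.mp ((eventually_prod_of_eventually hN_ev).and (hSrc_ev n s))
    refine ⟨max q₀.1 q₀.2, fun N hN N' hN' => ?_⟩
    have hq : q₀ ≤ (N, N') := Prod.mk_le_mk.mpr ⟨(le_max_left _ _).trans hN, (le_max_right _ _).trans hN'⟩
    have hq' := hq₀ (N, N') hq
    dsimp only at hq'
    obtain ⟨⟨⟨hEN, hAPN, hdepN⟩, ⟨hEN', hAPN', hdepN'⟩⟩, hsrc⟩ := hq'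
    -- the depth grading for the difference `Δ = Q_N − Q_{N'}`
    let G : ℕ → LoopSeq d → Prop := fun m t =>
      (∀ l ∈ t, ∀ a ∈ l, ∀ v : Site d,
          latticeNorm (v - DEdge.src a) ≤ ((m + D N : ℕ) : ℝ) ∨ latticeNorm (v - DEdge.tgt a) ≤ ((m + D N : ℕ) : ℝ) →
            v ∈ box d (M N)) ∧
        (∀ l ∈ t, ∀ a ∈ l, ∀ v : Site d,
          latticeNorm (v - DEdge.src a) ≤ ((m + D N' : ℕ) : ℝ) ∨ latticeNorm (v - DEdge.tgt a) ≤ ((m + D N' : ℕ) : ℝ) →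
            v ∈ box d (M N')) ∧
        Src (N, N') m t
    set Δ : LoopSeq d → ℝ := fun t => Q N t - Q N' t with hΔ
    -- (i) `Δ(∅) = 0`
    have hΔ0 : Δ [] = 0 := by simp only [hΔ, h0 N N', sub_self]
    -- (ii) leaves: the a priori bound
    have hleaf : ∀ t : LoopSeq d, IsLoopSeq t → G 0 t → |Δ t| ≤ 2 * B * (K ^ t.index * catProd t) := by
      intro t ht hg
      obtain ⟨hb, hb', -⟩ := hg
      simp only [zero_add] at hb hb'
      have h1 := hAPN t ht hb
      have h2 := hAPN' t ht hb'
      calc |Δ t| ≤ |Q N t| + |Q N' t| := abs_sub _ _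
        _ ≤ 2 * B * (K ^ t.index * catProd t) := by linarith
    -- (iii) inner nodes: the sourced equation and the compatibility of the grading
    have hnode : ∀ (m : ℕ) (t : LoopSeq d), G (m + 1) t →
        (IsLoopSeq t → t ≠ [] →
          |(t.len : ℝ) * Δ t -
            ((∑ o : InvIdx t, Δ (t.negSplitAt o)) - (∑ o : SameIdx t, Δ (t.posSplitAt o))
              + β * (∑ o : DeformIdx t, Δ (t.negDeformAt o)) - β * (∑ o : DeformIdx t, Δ (t.posDeformAt o)))| ≤
            η * t.len * (K ^ t.index * catProd t)) ∧
        (∀ o : SameIdx t, G m (t.posSplitAt o)) ∧ (∀ o : InvIdx t, G m (t.negSplitAt o)) ∧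
        (∀ o : DeformIdx t, G m (t.posDeformAt o)) ∧ (∀ o : DeformIdx t, G m (t.negDeformAt o)) := by
      intro m t hg
      obtain ⟨hb, hb', hsrc'⟩ := hg
      obtain ⟨hs0, hS, hI, hDp, hDn⟩ := hsrc'
      have hc := ball_compatible (box d (M N)) (m + D N) t (by simpa only [Nat.add_right_comm] using hb)
      have hc' := ball_compatible (box d (M N')) (m + D N') t (by simpa only [Nat.add_right_comm] using hb')
      refine ⟨fun ht htne => ?_, fun o => ⟨hc.2.1 o, hc'.2.1 o, hS o⟩, fun o => ⟨hc.2.2.1 o, hc'.2.2.1 o, hI o⟩,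
        fun o => ⟨hc.2.2.2.1 o, hc'.2.2.2.1 o, hDp o⟩, fun o => ⟨hc.2.2.2.2 o, hc'.2.2.2.2 o, hDn o⟩⟩
      have e1 := hEN t ht htne hc.1
      have e2 := hEN' t ht htne hc'.1
      have hdiff : (t.len : ℝ) * Δ t -
          ((∑ o : InvIdx t, Δ (t.negSplitAt o)) - (∑ o : SameIdx t, Δ (t.posSplitAt o))
            + β * (∑ o : DeformIdx t, Δ (t.negDeformAt o)) - β * (∑ o : DeformIdx t, Δ (t.posDeformAt o))) =
          SRC N t - SRC N' t := by
        rw [← e1, ← e2, hΔ]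
        simp only [Finset.sum_sub_distrib]
        ring
      rw [hdiff]
      have := hs0 ht htne
      rwa [hΦ] at this
    -- (iv) the target is at depth `n`
    have hGn : G n s :=
      ⟨ball_of_vertices_mem_box (by omega) hr, ball_of_vertices_mem_box (by omega) hr, hsrc⟩
    -- (v) contract
    have hmain := contraction_iterate (β := β) hK4 (by positivity : (0 : ℝ) ≤ 2 * B) hη0.le (by rw [← hPdef]; exact hθ)
      Δ hΔ0 G hleaf hnode n s hs hGn
    rw [← hPdef, ← hθdef] at hmain
    rw [Real.dist_eq]
    calc |Q N s - Q N' s| = |Δ s| := rfl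
      _ ≤ (2 * B * θ ^ n + 4 * η) * (K ^ s.index * catProd s) := hmain
      _ = 2 * B * θ ^ n * Φ s + 4 * η * Φ s := by rw [hΦ]; ring
      _ < ε / 2 + ε / 4 := by linarith
      _ < ε := by linarith
  exact cauchySeq_tendsto_of_complete hcauchy

end StringDuality

end Summit.QuantumFields.GaugeBoot

end
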